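import Literature.NumberTheory.IwasawaTheory.SymmetricThreeTowerExact
import HarnessLib

set_option autoImplicit false

/-!
# The two reflection classes of `S₃ × C₂` up a `ℤ₂`-tower: `e_n(L^{τ}) + e_n(L^{⟨σ,τz⟩}) = e_n(L^{τz}) + e_n(L^{⟨σ,τ⟩})` at every layer
# (an EXACT `2`-adic Brauer relation for `D₆ ≅ S₃ × C₂`, from the `S₃` relation run twice; proved, no definition, no named fact)

Topic `NumberTheory/IwasawaTheory` (namespace = path).  THEOREM-ONLY file, written by the prover seat `bsd-line-att-p3` g35 (cell `bsd-f1-sign2`,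
route `AlignedTransportAtTwo`, `--supports` stmt-BirchSwinnertonDyer-22298; closes nothing; nothing about elliptic curves or BSD is asserted here).
Sequel of att-p4 g30's `SymmetricThreeTowerExact.lean` (`classNumberPExp_symmetricThree_exact`: for `σ³ = 1`, `τ² = 1`, `τσ = σ²τ` in `Gal(L/F)`,
`e_n(L) + 2e_n(L^{⟨σ,τ⟩}) = e_n(L^{σ}) + 2e_n(L^{τ})` at every layer of a `ℤ₂`-tower `κ` of `F` — the `S₃`-pair need NOT generate `Gal(L/F)`).

SETTING.  `F` a number field, `κ` a `ℤ₂`-extension of `F`, `L/F` Galois with `κ ∘ res` onto, and `σ, τ, z ∈ Gal(L/F)` with `σ³ = 1`, `τ² = 1`,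
`τσ = σ²τ`, `z² = 1`, `zσ = σz`, `zτ = τz` (so `⟨σ, τ, z⟩` is a quotient of `S₃ × C₂ ≅ D₆`; typical case `Gal(L/F) = S₃ × C₂` with `z` central).
Then `τ' = τz` is again an involution inverting `σ`, and the `S₃` relation holds for BOTH pairs `(σ, τ)` and `(σ, τz)`, with the SAME terms
`e_n(L)` and `e_n(L^{σ})`; subtracting:

* §1 **`classNumberPExp_reflectionPair_exact`** — **`e_n(L^{τ}) + e_n(L^{⟨σ,τz⟩}) = e_n(L^{τz}) + e_n(L^{⟨σ,τ⟩})` for EVERY `n`** (no hypothesis on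
  class numbers): the two conjugacy classes of non-central involutions of `D₆` carry the same `2`-adic class-number content up to their quadratic
  «base» fields `L^{⟨σ,τ⟩}`, `L^{⟨σ,τz⟩}`.
* §2 growth form: `classicalMuVanishes_reflection_of_three` (`μ = 0` for the towers over `L^{τ}`, `L^{⟨σ,τ⟩}`, `L^{⟨σ,τz⟩}` ⟹ for `L^{τz}`) and
  **`classicalLambda_reflectionPair_exact`**: `λ(L^{τ}) + λ(L^{⟨σ,τz⟩}) = λ(L^{τz}) + λ(L^{⟨σ,τ⟩})`.

THE INTENDED INSTANCE (cell bsd-f1-sign2, crux C2, att-p3's PFμ⁺-carrier lane; NOT formalised here — the Galois bookkeeping of `M` is successor work):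
`F = ℚ`, `L = M = ℚ(W[2], √−1)` for an elliptic `W/ℚ` with `W(ℚ)[2] = 0`, `Δ_W, −Δ_W ∉ ℚ²`, so `Gal(M/ℚ) = Gal(ℚ(W[2])/ℚ) × Gal(ℚ(i)/ℚ) ≅ S₃ × C₂`,
`z` = complex-conjugation-type generator of `Gal(M/ℚ(W[2]))`, `σ` of order `3`, `τ` the transposition fixing `β_j` and `i`: `L^{τ} = ℚ(β_j, i)` (the CM
point field), `L^{τz} = ℚ(β_j, √−Δ_W)`, `L^{⟨σ,τ⟩} = ℚ(i)`, `L^{⟨σ,τz⟩} = ℚ(√−Δ_W)`, `L^{σ} = ℚ(i, √Δ_W)`.  Then §1 reads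
**`e_n(ℚ(β_j, √−1)) + e_n(ℚ(√−Δ_W)) = e_n(ℚ(β_j, √−Δ_W)) + e_n(ℚ(√−1)) = e_n(ℚ(β_j, √−Δ_W))`** (`e_n(ℚ(i)) = 0`: `h(ℚ(ζ_{2^{n+2}}))` is odd, Weber),
so `μ₂(ℚ(β_j,i)) = μ₂(ℚ(β_j,√−Δ_W))` and `λ₂(ℚ(β_j,√−Δ_W)) = λ₂(ℚ(β_j,i)) + λ₂(ℚ(√−Δ_W))` (Ferrero–Kida term): the two CM sextics of the `Δ_W > 0`
quarter carry the same `μ₂`, as att-p3 g34's memo §3.3 predicted from the `σχ`-isotypic part; and the first `S₃` relation itself reads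
`e_n(M) = e_n(ℚ(i,√Δ_W)) + 2e_n(ℚ(β_j,i))` (g34's «PFμ⁺ carrier ⟺ CM point field» made an exact identity).

References: [CaputoNuccio2020] Prop. 3.12, Rem. 3.13 (any `D_{2q}`, `ℓ ∤ q`); [Bartel2012] Cor. 5.2; [Washington1997] §13.1, §13.3 Thm. 13.13;
[Iwasawa1973MuInvariants] §4.
-/

noncomputable section

open scoped NumberField Classical
open NumberField Field IntermediateField

namespace Literature.NumberTheory.IwasawaTheory

open Literature.NumberTheory.EllipticCurves Literature.NumberTheory.EllipticCurves.ZpExtension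
  Literature.NumberTheory.GaloisRepresentations Literature.NumberTheory.NumberFields

variable {F : Type} [Field F] [NumberField F]

/-! ### §1 The exact reflection-pair relation at every layer -/

/-- `τz` is an involution inverting `σ` when `τ` is and `z` is a commuting involution. [folklore] -/
private theorem reflection_mul_central {G : Type} [Group G] {σ τ z : G} (hτ : τ ^ 2 = 1) (hτσ : τ * σ = σ ^ 2 * τ)
    (hz : z ^ 2 = 1) (hzσ : z * σ = σ * z) (hzτ : z * τ = τ * z) :
    (τ * z) ^ 2 = 1 ∧ (τ * z) * σ = σ ^ 2 * (τ * z) := by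
  constructor
  · calc (τ * z) ^ 2 = τ * (z * τ) * z := by rw [sq]; simp only [mul_assoc]
      _ = τ * (τ * z) * z := by rw [hzτ]
      _ = τ ^ 2 * z ^ 2 := by rw [sq, sq]; simp only [mul_assoc]
      _ = 1 := by rw [hτ, hz, one_mul]
  · calc (τ * z) * σ = τ * (z * σ) := by rw [mul_assoc]
      _ = τ * (σ * z) := by rw [hzσ]
      _ = (τ * σ) * z := by rw [mul_assoc]
      _ = σ ^ 2 * τ * z := by rw [hτσ]
      _ = σ ^ 2 * (τ * z) := by rw [mul_assoc]

/-- **The EXACT reflection-pair relation at layer `n`.**  `κ` a `ℤ₂`-extension of `F`, `L/F` Galois with `κ ∘ res` onto, `σ³ = 1`, `τ² = 1`,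
`τσ = σ²τ`, `z² = 1`, `zσ = σz`, `zτ = τz` in `Gal(L/F)`.  Then for every `n`:
**`e_n(L^{τ}) + e_n(L^{⟨σ,τz⟩}) = e_n(L^{τz}) + e_n(L^{⟨σ,τ⟩})`** — the `S₃` relation (`classNumberPExp_symmetricThree_exact`, Walter / Caputo–Nuccio
Prop. 3.12 per layer) for the pairs `(σ, τ)` and `(σ, τz)` shares the terms `e_n(L)` and `e_n(L^{σ})`; subtract and halve.  No hypothesis on class
numbers, `μ`, parity or signs. [cite: CaputoNuccio2020, Prop. 3.12 and Rem. 3.13] [cite: Bartel2012, Cor. 5.2] [cite: Washington1997, §13.1] -/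
theorem classNumberPExp_reflectionPair_exact (κ : ZpExtension F 2) (L : Type) [Field L] [NumberField L] [Algebra F L]
    [IsGalois F L] (hL : Function.Surjective (κ.toContinuousMonoidHom.comp (absGaloisRestrict F L)))
    {σ τ z : L ≃ₐ[F] L} (hσ : σ ^ 3 = 1) (hτ : τ ^ 2 = 1) (hτσ : τ * σ = σ ^ 2 * τ)
    (hz : z ^ 2 = 1) (hzσ : z * σ = σ * z) (hzτ : z * τ = τ * z)
    (hR : Function.Surjective (κ.toContinuousMonoidHom.comp (absGaloisRestrict F ↥(fixedField (Subgroup.zpowers σ)))))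
    (hK : Function.Surjective (κ.toContinuousMonoidHom.comp (absGaloisRestrict F ↥(fixedField (Subgroup.zpowers τ)))))
    (hk : Function.Surjective (κ.toContinuousMonoidHom.comp
      (absGaloisRestrict F ↥(fixedField (Subgroup.closure ({σ, τ} : Set (L ≃ₐ[F] L)))))))
    (hK' : Function.Surjective (κ.toContinuousMonoidHom.comp (absGaloisRestrict F ↥(fixedField (Subgroup.zpowers (τ * z))))))
    (hk' : Function.Surjective (κ.toContinuousMonoidHom.comp
      (absGaloisRestrict F ↥(fixedField (Subgroup.closure ({σ, τ * z} : Set (L ≃ₐ[F] L)))))))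
    (n : ℕ) :
    classNumberPExp (κ.restrict ↥(fixedField (Subgroup.zpowers τ)) hK) n +
        classNumberPExp (κ.restrict ↥(fixedField (Subgroup.closure ({σ, τ * z} : Set (L ≃ₐ[F] L)))) hk') n =
      classNumberPExp (κ.restrict ↥(fixedField (Subgroup.zpowers (τ * z))) hK') n +
        classNumberPExp (κ.restrict ↥(fixedField (Subgroup.closure ({σ, τ} : Set (L ≃ₐ[F] L)))) hk) n := by
  obtain ⟨hτ', hτ'σ⟩ := reflection_mul_central hτ hτσ hz hzσ hzτ
  have h1 := classNumberPExp_symmetricThree_exact κ L hL hσ hτ hτσ hR hK hk n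
  have h2 := classNumberPExp_symmetricThree_exact κ L hL hσ hτ' hτ'σ hR hK' hk' n
  omega

/-! ### §2 Iwasawa invariants -/

/-- **Growth form transfers across the reflection pair**: `μ = 0` (growth form) for the towers over `L^{τ}`, `L^{⟨σ,τ⟩}` and `L^{⟨σ,τz⟩}` gives it
for `L^{τz}` (`e_n(L^{τz}) = e_n(L^{τ}) + e_n(L^{⟨σ,τz⟩}) − e_n(L^{⟨σ,τ⟩})`).  In the intended instance: `μ₂(ℚ(β_j, i)) = 0` ⟹ `μ₂(ℚ(β_j, √−Δ_W)) = 0`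
(the two quadratic terms being `ℚ(i)` and `ℚ(√−Δ_W)`), and symmetrically. [cite: CaputoNuccio2020, Prop. 3.12] [cite: Washington1997, §13.3] -/
theorem classicalMuVanishes_reflection_of_three (κ : ZpExtension F 2) (L : Type) [Field L] [NumberField L] [Algebra F L]
    [IsGalois F L] (hL : Function.Surjective (κ.toContinuousMonoidHom.comp (absGaloisRestrict F L)))
    {σ τ z : L ≃ₐ[F] L} (hσ : σ ^ 3 = 1) (hτ : τ ^ 2 = 1) (hτσ : τ * σ = σ ^ 2 * τ)
    (hz : z ^ 2 = 1) (hzσ : z * σ = σ * z) (hzτ : z * τ = τ * z)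
    (hR : Function.Surjective (κ.toContinuousMonoidHom.comp (absGaloisRestrict F ↥(fixedField (Subgroup.zpowers σ)))))
    (hK : Function.Surjective (κ.toContinuousMonoidHom.comp (absGaloisRestrict F ↥(fixedField (Subgroup.zpowers τ)))))
    (hk : Function.Surjective (κ.toContinuousMonoidHom.comp
      (absGaloisRestrict F ↥(fixedField (Subgroup.closure ({σ, τ} : Set (L ≃ₐ[F] L)))))))
    (hK' : Function.Surjective (κ.toContinuousMonoidHom.comp (absGaloisRestrict F ↥(fixedField (Subgroup.zpowers (τ * z))))))
    (hk' : Function.Surjective (κ.toContinuousMonoidHom.comp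
      (absGaloisRestrict F ↥(fixedField (Subgroup.closure ({σ, τ * z} : Set (L ≃ₐ[F] L)))))))
    (hμK : ClassicalMuVanishes (κ.restrict ↥(fixedField (Subgroup.zpowers τ)) hK))
    (hμk : ClassicalMuVanishes (κ.restrict ↥(fixedField (Subgroup.closure ({σ, τ} : Set (L ≃ₐ[F] L)))) hk))
    (hμk' : ClassicalMuVanishes (κ.restrict ↥(fixedField (Subgroup.closure ({σ, τ * z} : Set (L ≃ₐ[F] L)))) hk')) :
    ClassicalMuVanishes (κ.restrict ↥(fixedField (Subgroup.zpowers (τ * z))) hK') := by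
  obtain ⟨lK, νK, nK, hgK⟩ := hμK
  obtain ⟨lk, νk, nk, hgk⟩ := hμk
  obtain ⟨lk', νk', nk', hgk'⟩ := hμk'
  set N := max nK (max nk nk') with hN
  have key : ∀ n, N ≤ n → (classNumberPExp (κ.restrict ↥(fixedField (Subgroup.zpowers (τ * z))) hK') n : ℤ) + (lk * n + νk) =
      (lK * n + νK) + (lk' * n + νk') := by
    intro n hn
    have h1 := hgK n (le_trans (le_max_left _ _) hn)
    have h2 := hgk n (le_trans ((le_max_left _ _).trans (le_max_right _ _)) hn)
    have h3 := hgk' n (le_trans ((le_max_right _ _).trans (le_max_right _ _)) hn)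
    have h4 := classNumberPExp_reflectionPair_exact κ L hL hσ hτ hτσ hz hzσ hzτ hR hK hk hK' hk' n
    rw [← h1, ← h2, ← h3]
    exact_mod_cast (by omega : classNumberPExp (κ.restrict ↥(fixedField (Subgroup.zpowers (τ * z))) hK') n +
      classNumberPExp (κ.restrict ↥(fixedField (Subgroup.closure ({σ, τ} : Set (L ≃ₐ[F] L)))) hk) n =
      classNumberPExp (κ.restrict ↥(fixedField (Subgroup.zpowers τ)) hK) n +
      classNumberPExp (κ.restrict ↥(fixedField (Subgroup.closure ({σ, τ * z} : Set (L ≃ₐ[F] L)))) hk') n)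
  have hslope : lk ≤ lK + lk' := by
    by_contra hlt'
    have hlt := not_le.mp hlt'
    have hC := key (N + (Int.toNat (νK + νk' - νk) + 1)) (Nat.le_add_right _ _)
    have hnn : (0 : ℤ) ≤ classNumberPExp (κ.restrict ↥(fixedField (Subgroup.zpowers (τ * z))) hK')
      (N + (Int.toNat (νK + νk' - νk) + 1)) := by positivity
    push_cast at hC
    have hlt' : (lK : ℤ) + lk' + 1 ≤ lk := by exact_mod_cast hlt
    have ht : (νK + νk' - νk : ℤ) ≤ (Int.toNat (νK + νk' - νk) : ℤ) := Int.self_le_toNat _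
    nlinarith
  refine ⟨lK + lk' - lk, νK + νk' - νk, N, fun n hn => ?_⟩
  have h := key n hn
  push_cast [Nat.cast_sub hslope]
  linarith

/-- **The exact `λ` across the reflection pair**: if the towers over `L^{τ}`, `L^{⟨σ,τ⟩}`, `L^{⟨σ,τz⟩}` have `μ = 0` (growth form) then so does the
tower over `L^{τz}` and **`λ(L^{τ}) + λ(L^{⟨σ,τz⟩}) = λ(L^{τz}) + λ(L^{⟨σ,τ⟩})`**.  Intended instance: `λ₂(ℚ(β_j, √−Δ_W)) = λ₂(ℚ(β_j, √−1)) + λ₂(ℚ(√−Δ_W))`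
(Ferrero–Kida term), `λ₂(ℚ(i)) = 0`. [cite: CaputoNuccio2020, Prop. 3.12] [cite: Washington1997, §13.3 Thm. 13.13] -/
theorem classicalLambda_reflectionPair_exact (κ : ZpExtension F 2) (L : Type) [Field L] [NumberField L] [Algebra F L]
    [IsGalois F L] (hL : Function.Surjective (κ.toContinuousMonoidHom.comp (absGaloisRestrict F L)))
    {σ τ z : L ≃ₐ[F] L} (hσ : σ ^ 3 = 1) (hτ : τ ^ 2 = 1) (hτσ : τ * σ = σ ^ 2 * τ)
    (hz : z ^ 2 = 1) (hzσ : z * σ = σ * z) (hzτ : z * τ = τ * z)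
    (hR : Function.Surjective (κ.toContinuousMonoidHom.comp (absGaloisRestrict F ↥(fixedField (Subgroup.zpowers σ)))))
    (hK : Function.Surjective (κ.toContinuousMonoidHom.comp (absGaloisRestrict F ↥(fixedField (Subgroup.zpowers τ)))))
    (hk : Function.Surjective (κ.toContinuousMonoidHom.comp
      (absGaloisRestrict F ↥(fixedField (Subgroup.closure ({σ, τ} : Set (L ≃ₐ[F] L)))))))
    (hK' : Function.Surjective (κ.toContinuousMonoidHom.comp (absGaloisRestrict F ↥(fixedField (Subgroup.zpowers (τ * z))))))
    (hk' : Function.Surjective (κ.toContinuousMonoidHom.comp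
      (absGaloisRestrict F ↥(fixedField (Subgroup.closure ({σ, τ * z} : Set (L ≃ₐ[F] L)))))))
    (hμK : ClassicalMuVanishes (κ.restrict ↥(fixedField (Subgroup.zpowers τ)) hK))
    (hμk : ClassicalMuVanishes (κ.restrict ↥(fixedField (Subgroup.closure ({σ, τ} : Set (L ≃ₐ[F] L)))) hk))
    (hμk' : ClassicalMuVanishes (κ.restrict ↥(fixedField (Subgroup.closure ({σ, τ * z} : Set (L ≃ₐ[F] L)))) hk')) :
    ClassicalMuVanishes (κ.restrict ↥(fixedField (Subgroup.zpowers (τ * z))) hK') ∧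
      classicalLambda (κ.restrict ↥(fixedField (Subgroup.zpowers τ)) hK) +
          classicalLambda (κ.restrict ↥(fixedField (Subgroup.closure ({σ, τ * z} : Set (L ≃ₐ[F] L)))) hk') =
        classicalLambda (κ.restrict ↥(fixedField (Subgroup.zpowers (τ * z))) hK') +
          classicalLambda (κ.restrict ↥(fixedField (Subgroup.closure ({σ, τ} : Set (L ≃ₐ[F] L)))) hk) := by
  have hμK' := classicalMuVanishes_reflection_of_three κ L hL hσ hτ hτσ hz hzσ hzτ hR hK hk hK' hk' hμK hμk hμk'
  refine ⟨hμK', ?_⟩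
  obtain ⟨νK, nK, hgK⟩ := classicalLambda_spec _ hμK
  obtain ⟨νk, nk, hgk⟩ := classicalLambda_spec _ hμk
  obtain ⟨νk', nk', hgk'⟩ := classicalLambda_spec _ hμk'
  obtain ⟨νK', nK', hgK'⟩ := classicalLambda_spec _ hμK'
  set lK := classicalLambda (κ.restrict ↥(fixedField (Subgroup.zpowers τ)) hK)
  set lk := classicalLambda (κ.restrict ↥(fixedField (Subgroup.closure ({σ, τ} : Set (L ≃ₐ[F] L)))) hk)
  set lk' := classicalLambda (κ.restrict ↥(fixedField (Subgroup.closure ({σ, τ * z} : Set (L ≃ₐ[F] L)))) hk')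
  set lK' := classicalLambda (κ.restrict ↥(fixedField (Subgroup.zpowers (τ * z))) hK')
  set N := max (max nK nk) (max nk' nK') with hN
  -- for `n ≥ N` the identity reads `(lK + lk') n + C = (lK' + lk) n + C'`; two consecutive values pin the slopes
  have key : ∀ n, N ≤ n → ((lK : ℤ) * n + νK) + (lk' * n + νk') = (lK' * n + νK') + (lk * n + νk) := by
    intro n hn
    have h1 := hgK n (le_trans ((le_max_left _ _).trans (le_max_left _ _)) hn)
    have h2 := hgk n (le_trans ((le_max_right _ _).trans (le_max_left _ _)) hn)
    have h3 := hgk' n (le_trans ((le_max_left _ _).trans (le_max_right _ _)) hn)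
    have h4 := hgK' n (le_trans ((le_max_right _ _).trans (le_max_right _ _)) hn)
    have h5 := classNumberPExp_reflectionPair_exact κ L hL hσ hτ hτσ hz hzσ hzτ hR hK hk hK' hk' n
    rw [← h1, ← h2, ← h3, ← h4]
    exact_mod_cast h5
  have hA := key N le_rfl
  have hB := key (N + 1) (Nat.le_succ N)
  push_cast at hA hB
  have : (lK : ℤ) + lk' = lK' + lk := by linarith
  exact_mod_cast this

end Literature.NumberTheory.IwasawaTheory
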